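import Mathlib
import Literature.NumberTheory.LFunctions.WeilExplicit
import Literature.NumberTheory.LFunctions.WeilMarkovQuadratic
import Literature.NumberTheory.LFunctions.WeilWindowSimpleEven
import Literature.NumberTheory.LFunctions.WeilGroundState

/-!
# Sketch — first lemmas for the crux ideas on `GroundStateSimpleEven` (stmt-RiemannHypothesis-1526)

Ideator 1, round 1.  Every `def … : Prop` below is a CHECKABLE first statement of one idea card
(not proved here; it must only elaborate).  Normalisation = the tree's (`WeilExplicit.lean`,
`WeilMarkovQuadratic.lean`): `Q g = weilQuadratic g = W(g ⋆ g̃)`, `Re Q = P + 𝓔_a − M_a‖g‖²`,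
archimedean jump density `weilArchDensity t = e^{t/2}/(2 sinh t)`.
-/

noncomputable section

open Complex Filter Set MeasureTheory
open scoped Real Topology ComplexConjugate ArithmeticFunction.vonMangoldt FourierTransform

namespace Summit.RiemannHypothesis.RiemannHypothesis.Cruxes.GroundStateSimpleEven.Ideator1

open Literature.NumberTheory.LFunctions

/-! ## Card `hankel-parity-splitting` -/

/-- Half-window overlap with an exponential: `β_c(g₀) = ∫ g₀(x) e^{-c x} dx`
(`c = 2k + 1/2`, `k ≥ 0`: the exponents of the completely monotone archimedean density;
`c = -1/2`: the pole overlap `∫ g₀ e^{x/2}`). -/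
def halfOverlap (g₀ : ℝ → ℂ) (c : ℝ) : ℂ :=
  ∫ x : ℝ, g₀ x * (Real.exp (-(c * x)) : ℂ)

/-- The Hankel (anti-diagonal) autocorrelation of a half-profile at `sum = t`:
`R(t) = ∫ g₀(t − y) conj(g₀ y) dy` (real for every `g₀`; supported in `0 < t < 2a`). -/
def hankelCorr (g₀ : ℝ → ℂ) (t : ℝ) : ℝ :=
  (∫ y : ℝ, g₀ (t - y) * conj (g₀ y)).re

/-- **Hankel parity-splitting identity** (first lemma of card `hankel-parity-splitting`).
For a test function `g₀` supported in the right half-window `(0, a]`, with even / odd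
extensions `g₀(t) ± g₀(−t)` (both test functions on `[−a, a]`, equal `L²` norms):
`Re Q(odd ext) − Re Q(even ext)
   = 4·( Σ_{k ≥ 1} |β_{2k+1/2}(g₀)|² + Σ_{log n < 2a} Λ(n) n^{-1/2} R(log n) − |β_{-1/2}(g₀)|² )`.
Ingredients: `Re Q = P + 𝓔_a − M_a‖·‖²` (`weilQuadratic_re_eq_weilPoleForm_add_weilDirichletEnergy_sub`);
`D_t(odd) − D_t(even) = 4 R(t)` for `t > 0`; `weilArchDensity t = Σ_{k≥0} e^{-(2k+1/2)t}`
(complete monotonicity) so `∫₀^∞ weilArchDensity · R = Σ_{k≥0} |β_{2k+1/2}|²`; the pole difference is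
`−4(|β_{-1/2}|² + |β_{1/2}|²)`, and the `k = 0` archimedean square CANCELS the `β_{1/2}` pole square. -/
def HankelParitySplitting : Prop :=
  ∀ a : ℝ, 0 < a → ∀ g₀ : ℝ → ℂ, IsWeilTest g₀ → tsupport g₀ ⊆ Ioc 0 a →
    (weilQuadratic (fun t => g₀ t - g₀ (-t))).re - (weilQuadratic (fun t => g₀ t + g₀ (-t))).re =
      4 * ((∑' k : ℕ, ‖halfOverlap g₀ (2 * (k + 1 : ℝ) + 1 / 2)‖ ^ 2) +
        (∑ n ∈ weilPrimeIndex a, (Λ n : ℝ) / Real.sqrt n * hankelCorr g₀ (Real.log n)) -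
        ‖halfOverlap g₀ (-(1 / 2))‖ ^ 2)

/-- **Widder positivity of the archimedean Hankel form** (support lemma): the archimedean jump
density is completely monotone, `weilArchDensity t = Σ_{k≥0} e^{-(2k+1/2)t}` for `t > 0`, hence the
Hankel form `∫₀^∞ weilArchDensity(t) R(t) dt = ∫∫ weilArchDensity(x+y) g₀(x) conj g₀(y)` is a sum of
squares. -/
def ArchHankelSumOfSquares : Prop :=
  (∀ t : ℝ, 0 < t → HasSum (fun k : ℕ => Real.exp (-((2 * (k : ℝ) + 1 / 2) * t))) (weilArchDensity t)) ∧
  ∀ g₀ : ℝ → ℂ, IsWeilTest g₀ → tsupport g₀ ⊆ Ioi 0 →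
    HasSum (fun k : ℕ => ‖halfOverlap g₀ (2 * (k : ℝ) + 1 / 2)‖ ^ 2)
      (∫ t in Ioi (0 : ℝ), weilArchDensity t * hankelCorr g₀ t)

/-- **Variational consequence** (how the identity bites the crux): the even bottom is bounded by the
odd Rayleigh quotient of ANY half-profile minus its parity splitting,
`ε(a) ≤ (Re Q(odd ext g₀) − ΔQ(g₀)) / (2‖g₀‖²)`; so `liminf ΔQ > 0` along one odd minimising
sequence forces the odd bottom strictly above `ε(a)` (the ORDER half of the crux). -/
def EvenBottomLeOddRayleighSubSplitting : Prop :=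
  ∀ a : ℝ, 0 < a → ∀ g₀ : ℝ → ℂ, IsWeilTest g₀ → tsupport g₀ ⊆ Ioc 0 a →
    ∫ x, ‖g₀ x‖ ^ 2 ≠ 0 →
    weilGroundEnergy a ≤
      (weilQuadratic (fun t => g₀ t + g₀ (-t))).re / (2 * ∫ x, ‖g₀ x‖ ^ 2)

/-! ## Card `digamma-cbf-halfline` -/

/-- The archimedean Lévy symbol of the window-free Weil–Markov form:
`Ψ_∞(ξ) = ∫₀^∞ weilArchDensity(t) |e^{iξt} − 1|² dt`. -/
def archSymbol (ξ : ℝ) : ℝ :=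
  ∫ t in Ioi (0 : ℝ), weilArchDensity t * (2 - 2 * Real.cos (ξ * t))

/-- **Digamma = complete Bernstein function of `ξ²`** (first lemma of card `digamma-cbf-halfline`):
`Ψ_∞(ξ) = Re ψ(1/4 + iξ/2) − ψ(1/4) = 2 Σ_{k≥0} ξ² / (c_k (c_k² + ξ²))`, `c_k = 2k + 1/2`,
i.e. `Ψ_∞(ξ) = 2 φ(ξ²)` with `φ(λ) = Σ_k c_k^{-1} λ/(λ + c_k²)` a complete Bernstein function
(Stieltjes measure `Σ_k c_k^{-1} δ_{c_k²}`: the trivial zeros / `Γ(s/2)` poles seen from `Re s = 1/2`).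
This puts the archimedean Weil–Markov process in Kwaśnicki's class (symmetric Lévy process with
completely monotone jump density ⇔ exponent `φ(ξ²)`, `φ` CBF). -/
def ArchSymbolDigammaCBF : Prop :=
  ∀ ξ : ℝ,
    archSymbol ξ = (Complex.digamma (1 / 4 + ξ / 2 * I)).re - (Complex.digamma (1 / 4)).re ∧
    HasSum (fun k : ℕ => 2 * (ξ ^ 2 / ((2 * (k : ℝ) + 1 / 2) * ((2 * (k : ℝ) + 1 / 2) ^ 2 + ξ ^ 2))))
      (archSymbol ξ)

/-- **Fourier form of the archimedean Dirichlet energy** (support): for a test function `g`,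
`∫₀^∞ weilArchDensity(t) D_t(g) dt = (2π)⁻¹ ∫ Ψ_∞(ξ) |ĝ(ξ)|² dξ` with `ĝ(ξ) = weilMellin g (1/2 + iξ)`. -/
def ArchEnergyFourier : Prop :=
  ∀ g : ℝ → ℂ, IsWeilTest g →
    ∫ t in Ioi (0 : ℝ), weilArchDensity t * weilIncrement g t =
      (1 / (2 * π)) * ∫ ξ : ℝ, archSymbol ξ * ‖weilMellin g (1 / 2 + ξ * I)‖ ^ 2

/-- **Parity-ordered low spectrum of the archimedean window operator** (the load-bearing claim of the
card, stated variationally and junk-free exactly like the crux, for the PRIME-FREE, POLE-FREE form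
`q_∞(g) := ∫₀^∞ weilArchDensity(t) D_t(g) dt` on the window `[−a, a]`, at EVERY window): the bottom is
attained only in the even sector, is simple there, and the odd bottom is strictly higher — with a
witness `φ` and a gap `δ`. (Courant nodal count through the Kwaśnicki–Mucha extension, or Kwaśnicki's
half-line eigenfunctions; Bañuelos–Kulczycki did this for the Cauchy process.) -/
def ArchWindowParityOrdered : Prop :=
  ∀ a : ℝ, 0 < a → ∃ φ : ℝ → ℂ, ∃ δ : ℝ, 0 < δ ∧ ∀ g : ℝ → ℂ, IsWeilTest g → tsupport g ⊆ Icc (-a) a →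
    ∫ t, ‖g t‖ ^ 2 = (1 : ℝ) →
    ((∀ t, g (-t) = -g t) ∨ ((∀ t, g (-t) = g t) ∧ ∫ t, conj (φ t) * g t = 0)) →
      sInf {x : ℝ | ∃ h : ℝ → ℂ, IsWeilTest h ∧ tsupport h ⊆ Icc (-a) a ∧ ∫ t, ‖h t‖ ^ 2 = (1 : ℝ) ∧
          x = ∫ t in Ioi (0 : ℝ), weilArchDensity t * weilIncrement h t} + δ ≤
        ∫ t in Ioi (0 : ℝ), weilArchDensity t * weilIncrement g t

/-! ## Card `fourier-sign-graded-theta-model` -/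

/-- Connes' map `𝓔` in the additive variable: `(𝓔 f)(t) = e^{t/2} Σ_{n≥1} f(n e^t)`. -/
def thetaLift (f : ℝ → ℂ) (t : ℝ) : ℂ :=
  (Real.exp (t / 2) : ℂ) * ∑' n : ℕ, f ((n + 1 : ℝ) * Real.exp t)

/-- **Parity = Fourier sign under `𝓔`** (first lemma of card `fourier-sign-graded-theta-model`):
for an even Schwartz `f` with `f 0 = 0` and `𝓕 f = ε f`, `ε = ±1` (Mathlib's `𝓕`, kernel
`e^{-2πixy}`), Poisson summation gives `(𝓔 f)(−t) = ε (𝓔 f)(t)`: Fourier-even data (Hermite index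
`≡ 0 mod 4`) give window-EVEN vectors, Fourier-odd data (index `≡ 2 mod 4`) give window-ODD vectors. -/
def ThetaLiftParity : Prop :=
  ∀ (f : SchwartzMap ℝ ℂ) (ε : ℂ), (ε = 1 ∨ ε = -1) → (∀ x, f (-x) = f x) → f 0 = 0 →
    (∀ y, 𝓕 (f : ℝ → ℂ) y = ε * f y) → ∀ t : ℝ, thetaLift f (-t) = ε * thetaLift f t

/-- **`𝓔` lands in the radical of the explicit formula, RH-free** (support): the Mellin–Laplace
transform of `𝓔 f` factors through `ζ`: `weilMellin (𝓔 f) s = ζ(s) · ∫₀^∞ f(y) y^{s-1} dy` for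
`1 < Re s` (then by continuation it vanishes at every nontrivial zero, on or off the line). -/
def ThetaLiftMellin : Prop :=
  ∀ (f : SchwartzMap ℝ ℂ), (∀ x, f (-x) = f x) → f 0 = 0 → ∀ s : ℂ, 1 < s.re →
    weilMellin (thetaLift f) s = riemannZeta s * ∫ y in Ioi (0 : ℝ), f y * (y : ℂ) ^ (s - 1)

/-- The crux is `∀ a > 0, WeilWindowSimpleEven a` verbatim (`Iff.rfl` against the route decl
`Summit.RiemannHypothesis.RiemannHypothesis.Theses.WeilGroundState.GroundStateSimpleEven`; the route module is not
imported here only to keep this workfile independent of route-file rewrites). -/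
def CruxShape : Prop := ∀ a : ℝ, 0 < a → WeilWindowSimpleEven a

end Summit.RiemannHypothesis.RiemannHypothesis.Cruxes.GroundStateSimpleEven.Ideator1
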